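/-
Summits.ValiantsHypothesis.TribunalEnv — GENERATED by harness/kit/tribunal_env.py (2026-08-17T14:32:23Z); import-only aggregate for the kernel tribunal (D-0034).
NEVER import this from a Theorems/Theses/Cruxes file (gate4 2026-08-17). Regenerate + `ledger build Summits.ValiantsHypothesis.TribunalEnv` together (≤ hourly).
Contents: 2 Statement modules, strong-hypothesis library ABSENT, 74 Theses, 63 criterion/converse theorem modules (of 76 candidates; cap), 15 unbuilt skipped, 0 excluded after check.
Full lists: run/shared/lean/tribunal/env/ValiantsHypothesis.json
-/
import Summits.ValiantsHypothesis.Statement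
import Summits.ValiantsHypothesis.ValiantsHypothesis.Statement
import Summits.ValiantsHypothesis.ValiantsHypothesis.Theses.AlgebraicKWGames
import Summits.ValiantsHypothesis.ValiantsHypothesis.Theses.AnyonJets
import Summits.ValiantsHypothesis.ValiantsHypothesis.Theses.BarrierLever
import Summits.ValiantsHypothesis.ValiantsHypothesis.Theses.BinomialElusive
import Summits.ValiantsHypothesis.ValiantsHypothesis.Theses.BirkhoffNewtonClass
import Summits.ValiantsHypothesis.ValiantsHypothesis.Theses.BoolTransfer
import Summits.ValiantsHypothesis.ValiantsHypothesis.Theses.BorderApolarity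
import Summits.ValiantsHypothesis.ValiantsHypothesis.Theses.ChowBorderDepth3
import Summits.ValiantsHypothesis.ValiantsHypothesis.Theses.CirculantFourier
import Summits.ValiantsHypothesis.ValiantsHypothesis.Theses.ContractivityPrice
import Summits.ValiantsHypothesis.ValiantsHypothesis.Theses.Depth4
import Summits.ValiantsHypothesis.ValiantsHypothesis.Theses.DetQP
import Summits.ValiantsHypothesis.ValiantsHypothesis.Theses.DivisionGap
import Summits.ValiantsHypothesis.ValiantsHypothesis.Theses.ElementaryWordLength
import Summits.ValiantsHypothesis.ValiantsHypothesis.Theses.Elusive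
import Summits.ValiantsHypothesis.ValiantsHypothesis.Theses.FeketeSOS
import Summits.ValiantsHypothesis.ValiantsHypothesis.Theses.FermionicJet
import Summits.ValiantsHypothesis.ValiantsHypothesis.Theses.FermionizationDimension
import Summits.ValiantsHypothesis.ValiantsHypothesis.Theses.FifoMatching
import Summits.ValiantsHypothesis.ValiantsHypothesis.Theses.ForgivenCollisions
import Summits.ValiantsHypothesis.ValiantsHypothesis.Theses.FreeEnergyLift
import Summits.ValiantsHypothesis.ValiantsHypothesis.Theses.FreeFermionCLL
import Summits.ValiantsHypothesis.ValiantsHypothesis.Theses.FreeSubtorus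
import Summits.ValiantsHypothesis.ValiantsHypothesis.Theses.GCTMult
import Summits.ValiantsHypothesis.ValiantsHypothesis.Theses.GaugeDescent
import Summits.ValiantsHypothesis.ValiantsHypothesis.Theses.GeneratorObstructions
import Summits.ValiantsHypothesis.ValiantsHypothesis.Theses.GirthSidon
import Summits.ValiantsHypothesis.ValiantsHypothesis.Theses.GrenetRigidity
import Summits.ValiantsHypothesis.ValiantsHypothesis.Theses.GrenetZeon
import Summits.ValiantsHypothesis.ValiantsHypothesis.Theses.HartogsRankTwo
import Summits.ValiantsHypothesis.ValiantsHypothesis.Theses.ImmanantSlice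
import Summits.ValiantsHypothesis.ValiantsHypothesis.Theses.IntegralGCT
import Summits.ValiantsHypothesis.ValiantsHypothesis.Theses.IntegralOrbits
import Summits.ValiantsHypothesis.ValiantsHypothesis.Theses.LacunarySymmetroid
import Summits.ValiantsHypothesis.ValiantsHypothesis.Theses.LangWeilTransfer
import Summits.ValiantsHypothesis.ValiantsHypothesis.Theses.LiftNullstellensatz
import Summits.ValiantsHypothesis.ValiantsHypothesis.Theses.LiouvilleSarnak
import Summits.ValiantsHypothesis.ValiantsHypothesis.Theses.MonotoneRestoration
import Summits.ValiantsHypothesis.ValiantsHypothesis.Theses.NewtonFrames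
import Summits.ValiantsHypothesis.ValiantsHypothesis.Theses.NewtonUnitEquations
import Summits.ValiantsHypothesis.ValiantsHypothesis.Theses.NumTame
import Summits.ValiantsHypothesis.ValiantsHypothesis.Theses.OneNatPerBit
import Summits.ValiantsHypothesis.ValiantsHypothesis.Theses.PartialSorting
import Summits.ValiantsHypothesis.ValiantsHypothesis.Theses.PermanentClass
import Summits.ValiantsHypothesis.ValiantsHypothesis.Theses.PermanentalCones
import Summits.ValiantsHypothesis.ValiantsHypothesis.Theses.PlantedHittingSets
import Summits.ValiantsHypothesis.ValiantsHypothesis.Theses.PolarDegree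
import Summits.ValiantsHypothesis.ValiantsHypothesis.Theses.PolyaContinued
import Summits.ValiantsHypothesis.ValiantsHypothesis.Theses.PrincipalMinorColouring
import Summits.ValiantsHypothesis.ValiantsHypothesis.Theses.ProjectionRigidity
import Summits.ValiantsHypothesis.ValiantsHypothesis.Theses.ProjectionStability
import Summits.ValiantsHypothesis.ValiantsHypothesis.Theses.ProofCarryingSymmetry
import Summits.ValiantsHypothesis.ValiantsHypothesis.Theses.RealTau
import Summits.ValiantsHypothesis.ValiantsHypothesis.Theses.RefutationDegree
import Summits.ValiantsHypothesis.ValiantsHypothesis.Theses.RigidMinimalReps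
import Summits.ValiantsHypothesis.ValiantsHypothesis.Theses.RigidityForcesSymmetry
import Summits.ValiantsHypothesis.ValiantsHypothesis.Theses.RyserTripartition
import Summits.ValiantsHypothesis.ValiantsHypothesis.Theses.SOSTau
import Summits.ValiantsHypothesis.ValiantsHypothesis.Theses.ScaledPencil
import Summits.ValiantsHypothesis.ValiantsHypothesis.Theses.SchenstedIndex
import Summits.ValiantsHypothesis.ValiantsHypothesis.Theses.ShallowShadows
import Summits.ValiantsHypothesis.ValiantsHypothesis.Theses.SliceSignRank
import Summits.ValiantsHypothesis.ValiantsHypothesis.Theses.SqrtTowers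
import Summits.ValiantsHypothesis.ValiantsHypothesis.Theses.StableRankCancellation
import Summits.ValiantsHypothesis.ValiantsHypothesis.Theses.StatementJunkGuard
import Summits.ValiantsHypothesis.ValiantsHypothesis.Theses.SummationBits
import Summits.ValiantsHypothesis.ValiantsHypothesis.Theses.SymPencil
import Summits.ValiantsHypothesis.ValiantsHypothesis.Theses.SymmetroidDescartes
import Summits.ValiantsHypothesis.ValiantsHypothesis.Theses.TauConst
import Summits.ValiantsHypothesis.ValiantsHypothesis.Theses.TwistedDetRank
import Summits.ValiantsHypothesis.ValiantsHypothesis.Theses.TwoAdicLadder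
import Summits.ValiantsHypothesis.ValiantsHypothesis.Theses.UlrichPadded
import Summits.ValiantsHypothesis.ValiantsHypothesis.Theses.UnpaddedGIT
import Summits.ValiantsHypothesis.ValiantsHypothesis.Theses.ValuativeGCT
import Summits.ValiantsHypothesis.ValiantsHypothesis.Theorems.BarrierLeverDefinableEquationsInfinitelyOften
import Summits.ValiantsHypothesis.ValiantsHypothesis.Theorems.ClassTransfer.Negative.ObliviousSplit
import Summits.ValiantsHypothesis.ValiantsHypothesis.Theorems.BarrierLeverDefinableEquationsInfinitelyOftenDual
import Summits.ValiantsHypothesis.ValiantsHypothesis.Theorems.ProofCarryingSymmetryPerLineAssembly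
import Summits.ValiantsHypothesis.ValiantsHypothesis.Theorems.ClassTransfer.Negative.CoverBalanceFamilies
import Summits.ValiantsHypothesis.ValiantsHypothesis.Theorems.MonotoneRestorationPolylogWidthMonotoneEasyComplex
import Summits.ValiantsHypothesis.ValiantsHypothesis.Theorems.ValuativeGCTValuativeFlipBorderPaddingMonotone
import Summits.ValiantsHypothesis.ValiantsHypothesis.Theorems.FeketeSOSCharPSparseSOSOrderedDoor
import Summits.ValiantsHypothesis.ValiantsHypothesis.Theorems.ProofCarryingSymmetryRestorationQPArithmeticCFIDichotomy
import Summits.ValiantsHypothesis.ValiantsHypothesis.Theorems.StatementJunkGuardArithCircuitExistsComputesProved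
import Summits.ValiantsHypothesis.ValiantsHypothesis.Theorems.BorderApolarityGctBridge
import Summits.ValiantsHypothesis.ValiantsHypothesis.Theorems.ClassTransfer.Negative.SummitHard
import Summits.ValiantsHypothesis.ValiantsHypothesis.Theorems.ContractivityPriceAssembly
import Summits.ValiantsHypothesis.ValiantsHypothesis.Theorems.DivisionGapZeroOneTransferUnchargedAssembly
import Summits.ValiantsHypothesis.ValiantsHypothesis.Theorems.ElementaryWordLengthAssembly
import Summits.ValiantsHypothesis.ValiantsHypothesis.Theorems.FermionizationDimensionAssembly
import Summits.ValiantsHypothesis.ValiantsHypothesis.Theorems.ForgivenCollisionsAssembly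
import Summits.ValiantsHypothesis.ValiantsHypothesis.Theorems.ImmanantSliceAssembly
import Summits.ValiantsHypothesis.ValiantsHypothesis.Theorems.NewtonUnitEquationsAssembly
import Summits.ValiantsHypothesis.ValiantsHypothesis.Theorems.OneNatPerBitAssembly
import Summits.ValiantsHypothesis.ValiantsHypothesis.Theorems.PolyaContinuedAssembly
import Summits.ValiantsHypothesis.ValiantsHypothesis.Theorems.ProofCarryingSymmetryAssembly
import Summits.ValiantsHypothesis.ValiantsHypothesis.Theorems.RefutationDegreeAssembly
import Summits.ValiantsHypothesis.ValiantsHypothesis.Theorems.RigidMinimalRepsExpDcGlue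
import Summits.ValiantsHypothesis.ValiantsHypothesis.Theorems.RigidityForcesSymmetryGrenetBoundToVH
import Summits.ValiantsHypothesis.ValiantsHypothesis.Theorems.ScaledPencilAssembly
import Summits.ValiantsHypothesis.ValiantsHypothesis.Theorems.SymPencilAssembly
import Summits.ValiantsHypothesis.ValiantsHypothesis.Theorems.SymPencilHubPerNotVp
import Summits.ValiantsHypothesis.ValiantsHypothesis.Theorems.UlrichPaddedAssembly
import Summits.ValiantsHypothesis.ValiantsHypothesis.Theorems.UnpaddedGITAssembly
import Summits.ValiantsHypothesis.ValiantsHypothesis.Cruxes.SOSMagnification.Disproof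
import Summits.ValiantsHypothesis.ValiantsHypothesis.Cruxes.ValuativeFlip.AuditFourRowCountK6G1
import Summits.ValiantsHypothesis.ValiantsHypothesis.Theorems.ClassTransfer.Negative.ConeLevel
import Summits.ValiantsHypothesis.ValiantsHypothesis.Theorems.ClassTransfer.Negative.EvenCycleDetPerHard
import Summits.ValiantsHypothesis.ValiantsHypothesis.Theorems.ClassTransfer.Negative.FalsifierPerHard
import Summits.ValiantsHypothesis.ValiantsHypothesis.Theorems.DetQPDetqpThesisHyperdetCalibrationEquiv
import Summits.ValiantsHypothesis.ValiantsHypothesis.Theorems.DetQPDetqpThesisRankHardnessCalibration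
import Summits.ValiantsHypothesis.ValiantsHypothesis.Theorems.DetQPDetqpThesisTransfer
import Summits.ValiantsHypothesis.ValiantsHypothesis.Theorems.DivisionGapPerNotVPToVH
import Summits.ValiantsHypothesis.ValiantsHypothesis.Theorems.ElementaryWordLengthWordPerSuperPolyOfNewtonTau
import Summits.ValiantsHypothesis.ValiantsHypothesis.Theorems.ElementaryWordLengthWordPerSuperQuarticPatternEquivalence
import Summits.ValiantsHypothesis.ValiantsHypothesis.Theorems.FreeFermionCLLDcqpToVH
import Summits.ValiantsHypothesis.ValiantsHypothesis.Theorems.ImmanantSliceEvenCycleCoverNotVP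
import Summits.ValiantsHypothesis.ValiantsHypothesis.Theorems.LiftNullstellensatzAssembly
import Summits.ValiantsHypothesis.ValiantsHypothesis.Theorems.MonotoneRestorationPolylogWidthMonotoneEasyStatus
import Summits.ValiantsHypothesis.ValiantsHypothesis.Theorems.TwistedDetRankFermionicNormalFormDefs
import Summits.ValiantsHypothesis.ValiantsHypothesis.Theorems.TwistedDetRankFermionicNormalFormSummitHard
import Summits.ValiantsHypothesis.ValiantsHypothesis.Theorems.BarrierLeverDefinableEquationsInfinitelyOftenReduction
import Summits.ValiantsHypothesis.ValiantsHypothesis.Theorems.Depth4Assembly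
import Summits.ValiantsHypothesis.ValiantsHypothesis.Theorems.DetQPDetqpThesisHyperdetCalibrationBorder
import Summits.ValiantsHypothesis.ValiantsHypothesis.Theorems.DetQPDetqpThesisHyperdetCalibrationHigh
import Summits.ValiantsHypothesis.ValiantsHypothesis.Theorems.DivisionGapZeroOneTransferStubDimerFamilyVP
import Summits.ValiantsHypothesis.ValiantsHypothesis.Theorems.ElementaryWordLengthWordLengthQPLadderIff
import Summits.ValiantsHypothesis.ValiantsHypothesis.Theorems.ElementaryWordLengthWordLengthQPRung0Nonuniversal
import Summits.ValiantsHypothesis.ValiantsHypothesis.Theorems.ElusiveAssembly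
import Summits.ValiantsHypothesis.ValiantsHypothesis.Theorems.FeketeSOSCharPSparseSOSOrderedCore
import Summits.ValiantsHypothesis.ValiantsHypothesis.Theorems.HubHub
import Summits.ValiantsHypothesis.ValiantsHypothesis.Theorems.MonotoneRestorationMonotoneRestorationQPVHImpliesNIHard
import Summits.ValiantsHypothesis.ValiantsHypothesis.Theorems.PermanentalConesHyperbolicVPShadowBridges
import Summits.ValiantsHypothesis.ValiantsHypothesis.Theorems.PermanentalConesHyperbolicVPShadowEquiv
import Summits.ValiantsHypothesis.ValiantsHypothesis.Theorems.RigidMinimalRepsMinimalRepTorusSymmetricCalibration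
import Summits.ValiantsHypothesis.ValiantsHypothesis.Theorems.TwistedDetRankFermionicNormalFormLocalGenerators
import Summits.ValiantsHypothesis.ValiantsHypothesis.Theorems.ValuativeGCTValuativeFlipBorderComplexityWindow
import HarnessLib.Audit.TribunalTags
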